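import Literature.Probability.RandomPlanarGeometry.LatticeSimilarityCovariance
import HarnessLib

/-!
# The zoom (mesh) flow on chordal curve families

Topic `Literature/Probability/RandomPlanarGeometry` (definition item `ChordalFamily.zoom`, route
`CriticalPhenomena/SAWZoomRigidity`: crux `ZoomRigidity`, support `ZoomInvariantLimitSet`).

For a chordal curve family `P : ChordalFamily = DobrushinDomain → Measure (CurveClass ℂ)` and a
scale `r ≠ 0`, `P.zoom r` is "the family looked at at scale `r`": the law in the dilated domain
`r · D`, shrunk back to `D`,
`P.zoom r D = (dil_{r⁻¹})_* (P (r · D))`, `dil_c = similarity c _ 0 : z ↦ c z`.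
This is the curve-family analogue of the scenery flow `S_t` of Hochman, *Dynamics on fractals and
fractal distributions* (arXiv:1008.3731), Def. 1.2, and of the `N⁻¹ ω` rescaling of
Lawler–Schramm–Werner, *On the scaling limit of planar self-avoiding walk* (2004), §3.4.2; dilation
covariance (Werner 2007, §3.2 (1) with `w = 0`, `c = r > 0`) is exactly `zoom`-invariance
(`isDilationCovariant_iff`).

## Contents (all proved)

* `similarity_one`, `similarity_trans_similarity`, `MarkedDomain.map_refl`,
  `CurveClass.map_homeomorph_refl` — bookkeeping for `z ↦ c z`;
* `ChordalFamily.zoom r P` (total in `r`; the junk value at `r = 0` is `P`), `zoom_apply`,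
  `zoom_zero`, `zoom_one`, `zoom_mul` (a flow: `zoom (r s) = zoom r ∘ zoom s`),
  `zoom_spec : P (r · D) = (dil_r)_* (P.zoom r D)` and its converse `zoom_unique`;
* `ChordalFamily.IsDilationCovariant P :↔ ∀ r > 0, P.zoom r = P`, and `isDilationCovariant_iff`
  (equivalence with the dilation clause `P (r · D) = (dil_r)_* (P D)`).

## References

* G. F. Lawler, O. Schramm, W. Werner, *On the scaling limit of planar self-avoiding walk*, in
  Fractal geometry and applications, Proc. Sympos. Pure Math. 72 (2004), §3.4.2.
* M. Hochman, *Dynamics on fractals and fractal distributions*, arXiv:1008.3731, Def. 1.2.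
* W. Werner, *Lectures on two-dimensional critical percolation*, IAS/Park City (2007), §3.2 (1).
-/

noncomputable section

open MeasureTheory Set

namespace Literature.Probability.RandomPlanarGeometry

/-! ### Dilations `z ↦ c z` -/

/-- The similarity with `c = 1`, `w = 0` is the identity. [folklore] -/
theorem similarity_one : similarity 1 one_ne_zero 0 = Homeomorph.refl ℂ := by
  ext z
  simp

/-- Composition of two centred similarities: `(z ↦ d z) ∘ (z ↦ c z) = (z ↦ (d c) z)`. [folklore] -/
theorem similarity_trans_similarity (c d : ℂ) (hc : c ≠ 0) (hd : d ≠ 0) :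
    (similarity c hc 0).trans (similarity d hd 0) = similarity (d * c) (mul_ne_zero hd hc) 0 := by
  ext z
  simp [mul_assoc]

/-- Two centred similarities with equal ratios are equal (the proof argument is irrelevant).
[folklore] -/
theorem similarity_congr {c d : ℂ} (hc : c ≠ 0) (hd : d ≠ 0) (h : c = d) :
    similarity c hc 0 = similarity d hd 0 := by
  subst h
  rfl

/-- The image of a marked domain under the identity is itself. [folklore] -/
theorem MarkedDomain.map_refl {n : ℕ} (D : MarkedDomain n) : D.map (Homeomorph.refl ℂ) = D :=
  MarkedDomain.ext (JordanDomain.ext (by simp) rfl) rfl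

/-- Push-forward of curve classes along the identity homeomorphism is the identity. [folklore] -/
theorem CurveClass.map_homeomorph_refl :
    CurveClass.map ((Homeomorph.refl ℂ : ℂ ≃ₜ ℂ) : C(ℂ, ℂ)) = id := by
  funext c
  obtain ⟨γ, rfl⟩ := CurveClass.surjective_mk c
  rfl

namespace ChordalFamily

/-! ### The zoom flow -/

/-- The dilation `z ↦ r z` for a nonzero real ratio, as a plane homeomorphism. [folklore] -/
abbrev dil (r : ℝ) (hr : r ≠ 0) : ℂ ≃ₜ ℂ :=
  similarity (r : ℂ) (Complex.ofReal_ne_zero.2 hr) 0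

/-- **The zoom (mesh) flow**: `P.zoom r D = (dil_{r⁻¹})_* (P (r · D))` — the law of the family in
the dilated domain `r · D`, shrunk back into `D` ("the family at scale `r`"; the curve-family
analogue of Hochman's scenery flow, Def. 1.2, and of the `N⁻¹ω` rescaling of LSW 2004 §3.4.2).
Total in `r`; at the junk value `r = 0` it is `P`. [cite: Hochman2010FractalDistributions, Def. 1.2] -/
def zoom (r : ℝ) (P : ChordalFamily) : ChordalFamily :=
  if hr : r = 0 then P else fun D =>
    (P (D.map (dil r hr))).map (CurveClass.map (dil r⁻¹ (inv_ne_zero hr) : C(ℂ, ℂ)))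

variable {r s : ℝ} (P : ChordalFamily)

/-- Unfolding `zoom` at a nonzero scale. [folklore] -/
theorem zoom_apply (hr : r ≠ 0) (D : DobrushinDomain) :
    P.zoom r D = (P (D.map (dil r hr))).map (CurveClass.map (dil r⁻¹ (inv_ne_zero hr) : C(ℂ, ℂ))) := by
  rw [zoom, dif_neg hr]

/-- The junk value: `zoom 0 P = P`. [folklore] -/
@[simp] theorem zoom_zero : P.zoom 0 = P := dif_pos rfl

/-- `dil 1 = id`. [folklore] -/
theorem dil_one : dil 1 one_ne_zero = Homeomorph.refl ℂ := by
  rw [← similarity_one]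
  exact similarity_congr _ _ (by simp)

/-- `dil s ∘ dil r`… as homeomorphisms: `(dil r).trans (dil s) = dil (r s)`. [folklore] -/
theorem dil_trans_dil (hr : r ≠ 0) (hs : s ≠ 0) :
    (dil r hr).trans (dil s hs) = dil (r * s) (mul_ne_zero hr hs) := by
  rw [dil, dil, similarity_trans_similarity]
  exact similarity_congr _ _ (by push_cast; ring)

/-- `(dil r).trans (dil r⁻¹) = id`. [folklore] -/
theorem dil_trans_dil_inv (hr : r ≠ 0) : (dil r hr).trans (dil r⁻¹ (inv_ne_zero hr)) = Homeomorph.refl ℂ := by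
  rw [dil_trans_dil hr (inv_ne_zero hr), ← dil_one]
  exact similarity_congr _ _ (by rw [mul_inv_cancel₀ hr])

/-- `(dil r⁻¹).trans (dil r) = id`. [folklore] -/
theorem dil_inv_trans_dil (hr : r ≠ 0) : (dil r⁻¹ (inv_ne_zero hr)).trans (dil r hr) = Homeomorph.refl ℂ := by
  rw [dil_trans_dil (inv_ne_zero hr) hr, ← dil_one]
  exact similarity_congr _ _ (by rw [inv_mul_cancel₀ hr])

/-- **`zoom 1 = id`.** [folklore] -/
@[simp] theorem zoom_one : P.zoom 1 = P := by
  funext D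
  rw [zoom_apply P one_ne_zero, dil_one, MarkedDomain.map_refl]
  have h : dil (1 : ℝ)⁻¹ (inv_ne_zero one_ne_zero) = Homeomorph.refl ℂ := by
    rw [← dil_one]; exact similarity_congr _ _ (by simp)
  rw [h, CurveClass.map_homeomorph_refl, Measure.map_id]

/-- **Flow property**: `zoom (r s) P = zoom r (zoom s P)` for `r, s ≠ 0`. [folklore] -/
theorem zoom_mul (hr : r ≠ 0) (hs : s ≠ 0) : P.zoom (r * s) = (P.zoom s).zoom r := by
  funext D
  rw [zoom_apply _ (mul_ne_zero hr hs), zoom_apply _ hr, zoom_apply _ hs, MarkedDomain.map_map,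
    dil_trans_dil hr hs,
    Measure.map_map (measurable_curveClassMap_similarity _ _ _) (measurable_curveClassMap_similarity _ _ _),
    ← CurveClass.map_homeomorph_trans, dil_trans_dil (inv_ne_zero hs) (inv_ne_zero hr)]
  congr 3
  · exact similarity_congr _ _ (by rw [mul_inv_rev])

/-- **Characterisation used by the route** (`P (r · D) = (dil_r)_* (P.zoom r D)`): the law in the
dilated domain is the push-forward along the dilation of the zoomed law. [folklore] -/
theorem zoom_spec (hr : r ≠ 0) (D : DobrushinDomain) :
    P (D.map (dil r hr)) = (P.zoom r D).map (CurveClass.map (dil r hr : C(ℂ, ℂ))) := by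
  rw [zoom_apply P hr, Measure.map_map (measurable_curveClassMap_similarity _ _ _)
    (measurable_curveClassMap_similarity _ _ _), ← CurveClass.map_homeomorph_trans,
    dil_inv_trans_dil hr, CurveClass.map_homeomorph_refl, Measure.map_id]

/-- **Converse / uniqueness**: the zoomed law is the ONLY measure whose push-forward along `dil r`
is `P (r · D)` (push-forward along a homeomorphism is injective). [folklore] -/
theorem zoom_unique (hr : r ≠ 0) {D : DobrushinDomain} {Q : Measure (CurveClass ℂ)}
    (hQ : P (D.map (dil r hr)) = Q.map (CurveClass.map (dil r hr : C(ℂ, ℂ)))) : P.zoom r D = Q := by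
  rw [zoom_apply P hr, hQ, Measure.map_map (measurable_curveClassMap_similarity _ _ _)
    (measurable_curveClassMap_similarity _ _ _), ← CurveClass.map_homeomorph_trans,
    dil_trans_dil_inv hr, CurveClass.map_homeomorph_refl, Measure.map_id]

/-! ### Dilation covariance as zoom invariance -/

/-- **Dilation covariance** of a chordal family: it is a fixed point of the zoom flow,
`P.zoom r = P` for all `r > 0` (Werner 2007 §3.2 (1) with `w = 0`, `c = r > 0`; the scenery-flow
invariance of Hochman, Def. 1.2). [cite: Werner2007, §3.2 (1)] -/
def IsDilationCovariant (P : ChordalFamily) : Prop :=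
  ∀ r : ℝ, 0 < r → P.zoom r = P

/-- Dilation covariance is the dilation clause of similarity covariance:
`P (r · D) = (dil_r)_* (P D)` for all `D` and `r > 0`. [cite: Werner2007, §3.2 (1)] -/
theorem isDilationCovariant_iff (P : ChordalFamily) :
    P.IsDilationCovariant ↔
      ∀ (D : DobrushinDomain) (r : ℝ) (hr : 0 < r),
        P (D.map (dil r hr.ne')) = (P D).map (CurveClass.map (dil r hr.ne' : C(ℂ, ℂ))) := by
  constructor
  · intro h D r hr
    conv_rhs => rw [← h r hr]
    exact P.zoom_spec hr.ne' D
  · intro h r hr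
    funext D
    exact P.zoom_unique hr.ne' (h D r hr)

/-- A similarity-covariant family (all `z ↦ c z + w`, `c ≠ 0`) is dilation covariant. [cite: Werner2007, §3.2 (1)] -/
theorem IsSimilarityCovariant.isDilationCovariant {P : ChordalFamily} (h : P.IsSimilarityCovariant) :
    P.IsDilationCovariant :=
  (isDilationCovariant_iff P).2 fun D r hr => h D (r : ℂ) (Complex.ofReal_ne_zero.2 hr.ne') 0

end ChordalFamily

end Literature.Probability.RandomPlanarGeometry
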